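import Mathlib.NumberTheory.PrimeCounting
import Literature.Computability.AlgebraicComplexity.LRPencilOfMatrix
import Literature.Computability.AlgebraicComplexity.LRWeightCount
import Literature.Computability.AlgebraicComplexity.VonZurGathenRegularity
import Literature.Computability.AlgebraicComplexity.VonZurGathenSingPermHeight
import HarnessLib

/-!
# Landsberg–Ressayre, Thm. 2.8 — assembly: `lr_left_equivariant_lower` from regularity

Topic `Literature/Computability/AlgebraicComplexity`.  Final file of the bottom-up proof of the named
fact `lr_left_equivariant_lower` (`LandsbergRessayre.lean`; LR17 Thm. 2.8: an affine determinantal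
representation of `perm_m`, `m ≥ 3`, equivariant for the left monomial symmetries has size
`n ≥ 2^m - 1`).  The chain of files is

`LandsbergRessayreNormalForm` (regularity, LR17 §3.3; von zur Gathen's theorem as the named fact
`vonzurGathen1987_perm_detRepr_rank`) → `LRCanonicalSubspaces` (canonical subspaces `𝒫_S`,
covariance, escape) → `GenericTorusGrading`, `LRTorusWeights`, `LRCanonicalWeights` (weights of one
generic torus element on `𝒫_S`, descent) → `LRWeightCount` (top weight, chain, count:
`TorusData.two_pow_sub_one_le_finrank`) → `LRPencilOfMatrix` (from matrices to the pencil) → here.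

* `two_pow_sub_one_le_of_isRegular`: a REGULAR representation of ANY polynomial with an exact lift
  of every left monomial symmetry and an invertible member `Ã(v)` … — specialised here to `perm_m`:
  a regular, left-monomially-equivariant affine determinantal representation of `perm_m` (`m ≥ 1`)
  has size `≥ 2^m - 1` (LR17 Thm. 2.8 with regularity as hypothesis; LR obtain regularity from
  von zur Gathen, Lemma 3.2);
* `lr_left_equivariant_lower_of_vonzurGathen`: LR17 Thm. 2.8 (the tree's named fact) follows from
  von zur Gathen's regularity theorem (named fact `vonzurGathen1987_perm_detRepr_rank`);
* `lr_left_equivariant_lower_of_height_facts`: hence from the two height statements of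
  `VonZurGathenRegularity.lean` to which that theorem has been reduced;
* `lr_left_equivariant_lower_holds`: the DISCHARGE of the named fact — both height statements are
  now proved in the tree (`VonZurGathenRegularityProofs.lean`: Eagon's theorem for the submaximal
  minors; `VonZurGathenSingPermHeight.lean`: vzG87 Lemma 2.3 by explicit chains of primes, and the
  unconditional `vonzurGathen1987_perm_detRepr_rank_holds`), so LR17 Thm. 2.8 holds outright.

The proof of LR17 Thm. 2.8 in the tree is thus complete and unconditional: regularity comes from
von zur Gathen's 1987 theorem exactly as in LR17 Lemma 3.2, while LR's use of Levi–Malcev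
decompositions and central tori (LR17 §3.5, §6) is replaced by the canonical subspaces of
`LRCanonicalSubspaces.lean`.

## References

* J. M. Landsberg, N. Ressayre, *Permanent v. determinant: an exponential lower bound assuming
  symmetry and a potential path towards Valiant's conjecture*, Differential Geom. Appl. 55 (2017)
  146–166, arXiv:1508.05788: Thm. 2.8, Lemma 3.2, §6.
* J. von zur Gathen, *Permanent and determinant*, Linear Algebra Appl. 96 (1987) 87–100, Thm. 3.1.
-/

noncomputable section

namespace Literature.Computability.AlgebraicComplexity

open Matrix MvPolynomial Finset LRPencil
open scoped Kronecker

/-! ### LR17 Thm. 2.8 for regular representations -/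

section Assembly

variable {m n : ℕ}

/-- From an exact lift of `g ⊗ 1` (`g` monomial): matrices `P, Q ∈ GL_n` with `P Λ = Λ Q` and
`Σ_i (g ⊗ 1)_{w i} A_i = P A_w Q⁻¹` for every variable `w` (LR17 Def. 1.3 on the constant and
linear parts). [cite: LandsbergRessayre2017, Def. 1.3] -/
theorem exists_matrix_lift {A : Matrix (Fin n) (Fin n) (MvPolynomial (Fin m × Fin m) ℂ)}
    {f : MvPolynomial (Fin m × Fin m) ℂ} (hA : IsEquivariantDetRepr (leftMonomialSubst ℂ m) f A)
    {M : GL (Fin m) ℂ} (hM : M ∈ monomialSubgroup ℂ m) :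
    ∃ g h : GL (Fin n) ℂ, (g : Matrix (Fin n) (Fin n) ℂ) * constPart A = constPart A * (h : Matrix (Fin n) (Fin n) ℂ) ∧
      ∀ w, (∑ i, ((M : Matrix (Fin m) (Fin m) ℂ) ⊗ₖ (1 : Matrix (Fin m) (Fin m) ℂ)) w i • coeffMat A i) =
        (g : Matrix (Fin n) (Fin n) ℂ) * coeffMat A w * ((h⁻¹ : GL (Fin n) ℂ) : Matrix (Fin n) (Fin n) ℂ) := by
  obtain ⟨g, h, hgh, hΛ⟩ := hA.exists_lift_stabilising (kronecker_one_mem ℂ hM)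
  refine ⟨g, h, hΛ, fun w => ?_⟩
  have e : coeffMat (Matrix.linSubstEntries (Matrix.GeneralLinearGroup.kronecker M (1 : GL (Fin m) ℂ)) A) w =
      coeffMat ((g : Matrix (Fin n) (Fin n) ℂ).map C * A *
        ((h⁻¹ : GL (Fin n) ℂ) : Matrix (Fin n) (Fin n) ℂ).map C) w := by rw [hgh]
  rwa [coeffMat_linSubstEntries _ _ hA.1.1, coe_kronecker_one, coeffMat_C_mul_mul_C] at e

/-- Right multiplication by `h` turns `X = g Y h⁻¹` into `g Y = X h`. [folklore] -/
theorem mul_eq_of_eq_mul_mul_inv {g h : GL (Fin n) ℂ} {X Y : Matrix (Fin n) (Fin n) ℂ}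
    (e : X = (g : Matrix (Fin n) (Fin n) ℂ) * Y * ((h⁻¹ : GL (Fin n) ℂ) : Matrix (Fin n) (Fin n) ℂ)) :
    (g : Matrix (Fin n) (Fin n) ℂ) * Y = X * (h : Matrix (Fin n) (Fin n) ℂ) := by
  rw [e, Matrix.mul_assoc ((g : Matrix (Fin n) (Fin n) ℂ) * Y), ← Units.val_mul, inv_mul_cancel,
    Units.val_one, Matrix.mul_one]

/-- **LR17 Thm. 2.8 for regular representations** (elementary proof via canonical subspaces):
a REGULAR affine determinantal representation of `perm_m` (`m ≥ 1`) over `ℂ` which is equivariant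
(exact lifts) for the left monomial symmetries has size `n ≥ 2^m - 1`.  LR deduce regularity
from von zur Gathen's theorem (Lemma 3.2); here it is a hypothesis. [cite: LandsbergRessayre2017, Thm. 2.8] -/
theorem two_pow_sub_one_le_of_isRegular (hm : 1 ≤ m)
    {A : Matrix (Fin n) (Fin n) (MvPolynomial (Fin m × Fin m) ℂ)}
    (hA : IsEquivariantDetRepr (leftMonomialSubst ℂ m) (perPoly (Fin m) ℂ) A)
    (hreg : IsRegularDetRepr (perPoly (Fin m) ℂ) A) : 2 ^ m - 1 ≤ n := by
  classical
  have haff : ∀ r c, (A r c).totalDegree ≤ 1 := hA.1.1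
  have hdet : A.det = perPoly (Fin m) ℂ := hA.1.2
  set Λm : Matrix (Fin n) (Fin n) ℂ := constPart A with hΛm
  set Am : Fin m → Fin m → Matrix (Fin n) (Fin n) ℂ := fun k j => coeffMat A (k, j) with hAm
  -- the torus element `diag(2, 3, 5, …)` and its lift
  set p : Fin m → ℕ := fun i => Nat.nth Nat.Prime i with hpdef
  have hprime : ∀ i, (p i).Prime := fun i => Nat.prime_nth_prime _
  have hpinj : Function.Injective p := fun _ _ h =>
    Fin.ext (Nat.nth_injective Nat.infinite_setOf_prime h)
  have hp0 : ∀ i, ((fun i => (p i : ℂ)) i) ≠ 0 := fun i =>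
    Nat.cast_ne_zero.2 (hprime i).ne_zero
  obtain ⟨g, h, hΛ, hw⟩ := exists_matrix_lift hA (diagUnit_mem ℂ (fun i => (p i : ℂ)) hp0)
  have hAt : ∀ k j, (g : Matrix (Fin n) (Fin n) ℂ) * Am k j =
      (p k : ℂ) • (Am ((1 : Equiv.Perm (Fin m)) k) j * (h : Matrix (Fin n) (Fin n) ℂ)) := by
    intro k j
    have e := hw (k, j)
    rw [coe_diagUnit, sum_kron_diagonal_smul] at e
    rw [mul_eq_of_eq_mul_mul_inv e, Matrix.smul_mul]
    rfl
  let L : Lift (Matrix.toLin' Λm) (fun k j => Matrix.toLin' (Am k j)) 1 (fun k => (p k : ℂ)) :=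
    liftOfMatrices Λm Am 1 _ hp0 g h hΛ hAt
  -- the permutation lifts
  have hperm : ∀ σ : Equiv.Perm (Fin m),
      Nonempty (Lift (Matrix.toLin' Λm) (fun k j => Matrix.toLin' (Am k j)) σ fun _ => (1 : ℂ)) := by
    intro σ
    obtain ⟨g', h', hΛ', hw'⟩ := exists_matrix_lift hA (permUnit_mem ℂ σ)
    refine ⟨liftOfMatrices Λm Am σ _ (fun _ => one_ne_zero) g' h' hΛ' fun k j => ?_⟩
    have e := hw' (k, j)
    rw [coe_permUnit, sum_kron_permMatrix_smul] at e
    rw [mul_eq_of_eq_mul_mul_inv e, one_smul]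
  -- regularity: the kernel of `Λ` is a line
  have hK : Module.finrank ℂ (LinearMap.ker (Matrix.toLin' Λm)) = 1 := by
    have h1 := LinearMap.finrank_range_add_finrank_ker (Matrix.toLin' Λm)
    rw [Module.finrank_fin_fun] at h1
    have h2 : Module.finrank ℂ (LinearMap.range (Matrix.toLin' Λm)) = n - 1 := by
      rw [Matrix.toLin'_apply']; exact hreg.2
    have hn : 1 ≤ n := by
      rcases Nat.eq_zero_or_pos n with h0 | h0
      · subst h0
        exfalso
        have h3 : A.det = 1 := Matrix.det_isEmpty
        have h4 := congrArg constantCoeff hdet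
        rw [h3, constantCoeff_perPoly ℂ hm, map_one] at h4
        exact one_ne_zero h4
      · exact h0
    omega
  obtain ⟨γ₀, hγ₀, hker⟩ := exists_eigenvalue_of_finrank_ker_eq_one _ L.C L.map_ker_eq hK
  -- the torus datum
  let D : TorusData m (Fin n → ℂ) :=
    { Λ := Matrix.toLin' Λm, A := fun k j => Matrix.toLin' (Am k j), p := p,
      prime := hprime, p_inj := hpinj, L := L, γ₀ := γ₀, ker_le := hker, γ₀_ne := hγ₀ }
  -- an invertible member of the pencil: `Ã(1)`, of determinant `perm_m(1) = 1`
  have hgen : ∃ x : Fin m → Fin m → ℂ, Function.Injective (D.Λ + ∑ k, ∑ j, x k j • D.A k j) := by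
    let v : Fin m × Fin m → ℂ := fun w => if w.1 = w.2 then 1 else 0
    refine ⟨fun k j => v (k, j), ?_⟩
    have hmat : D.Λ + ∑ k, ∑ j, v (k, j) • D.A k j = Matrix.toLin' (A.map (MvPolynomial.eval v)) := by
      show Matrix.toLin' Λm + ∑ k, ∑ j, v (k, j) • Matrix.toLin' (Am k j) = _
      rw [map_eval_eq A haff v, map_add, map_sum, Fintype.sum_prod_type]
      simp only [map_smul]
      rfl
    have hdetv : (A.map (MvPolynomial.eval v)).det ≠ 0 := by
      have e : (A.map (MvPolynomial.eval v)).det = MvPolynomial.eval v A.det := by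
        rw [RingHom.map_det]; rfl
      rw [e, hdet, eval_perPoly]
      have hv1 : (Matrix.of fun i j : Fin m => v (i, j)) = 1 := by
        ext i j; simp [v, Matrix.one_apply]
      rw [hv1, Matrix.permanent_one]; exact one_ne_zero
    rw [hmat]
    have hunit : IsUnit (A.map (MvPolynomial.eval v)) :=
      (Matrix.isUnit_iff_isUnit_det _).2 (isUnit_iff_ne_zero.2 hdetv)
    intro x y hxy
    apply Matrix.mulVec_injective_iff_isUnit.2 hunit
    simpa [Matrix.toLin'_apply] using hxy
  have hmain := D.two_pow_sub_one_le_finrank hm hK hgen hperm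
  rwa [Module.finrank_fin_fun] at hmain

/-- LR17 Thm. 2.8 follows from the regularity of all left-equivariant representations of `perm_m`,
`m ≥ 3`. [cite: LandsbergRessayre2017, Thm. 2.8] -/
theorem lr_left_equivariant_lower_of_regular
    (hreg : ∀ m : ℕ, 3 ≤ m → ∀ (n : ℕ) (A : Matrix (Fin n) (Fin n) (MvPolynomial (Fin m × Fin m) ℂ)),
      IsEquivariantDetRepr (leftMonomialSubst ℂ m) (perPoly (Fin m) ℂ) A →
        IsRegularDetRepr (perPoly (Fin m) ℂ) A) :
    lr_left_equivariant_lower := fun m hm n A hA =>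
  two_pow_sub_one_le_of_isRegular (by omega) hA (hreg m hm n A hA)

/-- **LR17 Thm. 2.8 from von zur Gathen's theorem**: granted the named fact
`vonzurGathen1987_perm_detRepr_rank` (vzG87 Thm. 3.1: every determinantal representation of
`perm_m`, `m ≥ 3`, is regular — LR17 Lemma 3.2), the tree's named fact
`lr_left_equivariant_lower` holds. [cite: LandsbergRessayre2017, Thm. 2.8] -/
theorem lr_left_equivariant_lower_of_vonzurGathen (hvzg : vonzurGathen1987_perm_detRepr_rank) :
    lr_left_equivariant_lower :=
  lr_left_equivariant_lower_of_regular fun _ hm _ _ hA => hA.isRegular_perPoly hvzg hm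

/-- Hence LR17 Thm. 2.8 from the two height statements of `VonZurGathenRegularity.lean`
(vzG87 Lemma 2.1 + fibre dimension, and vzG87 Lemma 2.3, in the language of heights).
[cite: LandsbergRessayre2017, Thm. 2.8] -/
theorem lr_left_equivariant_lower_of_height_facts
    (h2 : VonZurGathen.vonzurGathen1987_submaximalMinors_height)
    (h3 : VonZurGathen.vonzurGathen1987_singPerm_height) : lr_left_equivariant_lower :=
  lr_left_equivariant_lower_of_vonzurGathen
    (VonZurGathen.vonzurGathen1987_perm_detRepr_rank_of_height_facts h2 h3)

/-- **LR17 Thm. 2.8 (Landsberg–Ressayre) — DISCHARGED.**  Let `m ≥ 3` and let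
`Ã : M_m(ℂ) → M_n(ℂ)` be an affine determinantal representation of `perm_m` (`perm_m = det ∘ Ã`)
that is equivariant with respect to the left monomial symmetries `x ↦ P_σ diag(c) x`
(`leftMonomialSubst ℂ m`, an exact lift of every element in the sense of LR17 Def. 1.2/1.3).  Then
`n ≥ 2^m - 1`.  Proof in the tree: regularity of `Ã` (von zur Gathen 1987, Thm. 3.1 — LR17
Lemma 3.2 — now the theorem `vonzurGathen1987_perm_detRepr_rank_holds`), then the weight count on
the canonical subspaces (`two_pow_sub_one_le_of_isRegular`, replacing LR17 §3.5–§6).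
[cite: LandsbergRessayre2017, Thm. 2.8] -/
theorem lr_left_equivariant_lower_holds : lr_left_equivariant_lower :=
  lr_left_equivariant_lower_of_vonzurGathen vonzurGathen1987_perm_detRepr_rank_holds

end Assembly

end Literature.Computability.AlgebraicComplexity
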